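import Summits.ABC.ABC.Theses.IsogenyGlueCongruence
import Summits.ABC.ABC.Theorems.IsogenyGlueCongruenceEllipticGluingPrimeBoundStubIsotypicBranchPolyOf
import Summits.ABC.ABC.Theorems.IsogenyGlueCongruenceEllipticGluingPrimeBoundStubCMIsotypicCoreOfAux2
import Literature.NumberTheory.EllipticCurves.MasserWustholzSurjectivity
import Literature.NumberTheory.EllipticCurves.CMTorsionGaloisImage
import HarnessLib

/-!
# Crux `EllipticGluingPrimeBound`, line Sketch — stub `stub_irreducibleThreshold`
# (irreducibility of `W[ℓ]` beyond a height-dependent threshold, from the two isotypic-branch facts)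

Stub `stub_irreducibleThreshold` (NEW in skeleton v9) of line `Sketch` (isotypic–Minkowski
reduction) of crux U `Summit.ABC.ABC.Theses.IsogenyGlueCongruence.EllipticGluingPrimeBound`
(stmt-ABC-13919).  In v9 Mazur's isogeny theorem is no longer an input of the line: the
irreducibility of the `Γ_ℚ`-module `W[ℓ]` that the dichotomy needs is supplied, beyond a
HEIGHT-DEPENDENT threshold `max(L₀, c · max(1, h_F(W))^γ)`, by the two named facts the isotypic
branch consumes anyway, taken here as HYPOTHESES (registered neighbours
`stub_masserWustholzSurjective`, `stub_cmTorsionCartanImage`):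

* `Literature.NumberTheory.EllipticCurves.masserWustholz_surjective_modEll` (Masser–Wüstholz 1993:
  non-CM `W/ℚ`, `ℓ > c · max(1, h_F(W))^γ` ⟹ `ρ̄_{W,ℓ}` surjective);
* `Literature.NumberTheory.EllipticCurves.cmTorsion_cartanImage` (the CM torsion fact: `√D` on
  `W[ℓ]`, its quadratic twisting character, the `12`-th powers of the Cartan in the image of `Γ_K`,
  for CM `W/ℚ` and `ℓ > L₀`).

**Statement.** MW fact → CM fact → there are `L₀ : ℕ`, `c γ : ℝ`, `0 ≤ γ`, such that for every
elliptic `W/ℚ` and every prime `ℓ` with `L₀ < ℓ` and `c · max(1, h_F(W))^γ < ℓ`, `W[ℓ]` is an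
irreducible `Γ_ℚ`-module (`WeierstrassCurve.HasIrreducibleModPGaloisRep`).

**Proof** (composition by name of two LANDED theorems of the line). Take `c, γ` from the MW fact
and `L₀` from `CMIsotypicCore.irreducible_of_cmCartanImage` (helpers 2/2 of
`stub_CMIsotypicCoreOf`, whose hypothesis is verbatim the body of `cmTorsion_cartanImage`). For a
CM curve the latter gives irreducibility at `ℓ > L₀`; for a non-CM curve the MW fact gives a
surjective mod-`ℓ` image at `ℓ > c · max(1, h_F(W))^γ`, hence irreducibility by
`surjective_irreducible_scalar_of_surjective` (file `…StubIsotypicBranchPolyOf`). Everything is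
proved (axioms `propext`, `Classical.choice`, `Quot.sound`); no `def`, no named fact is vendored
(the two facts are hypotheses, discharged by the neighbours in the skeleton).
-/

noncomputable section

-- `Summit.<Summit>.<Problem>` is the mandated summit-side namespace (CONVENTIONS §2); for the
-- single-conjunct summit `ABC` the two coincide, so the duplicate `ABC.ABC` is deliberate.
set_option linter.dupNamespace false

namespace Summit.ABC.ABC.Theorems.IsotypicMinkowski

open CategoryTheory CategoryTheory.Limits AlgebraicGeometry
open Literature.AlgebraicGeometry.Motives
open Summit.ABC.ABC.Theses.IsogenyGlueCongruence

/-- **Irreducibility threshold from the two isotypic-branch facts** (stub `stub_irreducibleThreshold`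
of line `Sketch`, v9). From the Masser–Wüstholz fact (non-CM `W`: surjective mod-`ℓ` image for
`ℓ > c · max(1, h_F(W))^γ`, hence irreducible — `surjective_irreducible_scalar_of_surjective`) and
the CM torsion fact (CM `W`: `CMIsotypicCore.irreducible_of_cmCartanImage` beyond its `L₀`):
`W[ℓ]` is an irreducible `Γ_ℚ`-module for every prime `ℓ > L₀` with `c · max(1, h_F(W))^γ < ℓ`.
[folklore] -/
theorem stub_irreducibleThreshold :
    Literature.NumberTheory.EllipticCurves.masserWustholz_surjective_modEll →
    Literature.NumberTheory.EllipticCurves.cmTorsion_cartanImage →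
    ∃ (L₀ : ℕ) (c γ : ℝ), 0 ≤ γ ∧ ∀ (W : WeierstrassCurve ℚ) [W.IsElliptic] (ℓ : ℕ), ℓ.Prime →
      L₀ < ℓ → c * (max 1 W.stableFaltingsHeight) ^ γ < ℓ → W.HasIrreducibleModPGaloisRep ℓ := by
  intro hMW hCM
  obtain ⟨c, γ, hγ, hmw⟩ := hMW
  obtain ⟨L₀, hcm⟩ := CMIsotypicCore.irreducible_of_cmCartanImage hCM
  refine ⟨L₀, c, γ, hγ, ?_⟩
  intro W _ ℓ hℓ hL hc
  by_cases h : W.HasCM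
  · exact hcm W h ℓ hℓ hL
  · exact (surjective_irreducible_scalar_of_surjective hℓ (hmw W h ℓ hℓ hc)).1

/-- **Curried form** of `stub_irreducibleThreshold` (same content, hypotheses named), for consumers
that hold the two facts as named hypotheses. [folklore] -/
theorem irreducibleThreshold_of_facts
    (hMW : Literature.NumberTheory.EllipticCurves.masserWustholz_surjective_modEll)
    (hCM : Literature.NumberTheory.EllipticCurves.cmTorsion_cartanImage) :
    ∃ (L₀ : ℕ) (c γ : ℝ), 0 ≤ γ ∧ ∀ (W : WeierstrassCurve ℚ) [W.IsElliptic] (ℓ : ℕ), ℓ.Prime →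
      L₀ < ℓ → c * (max 1 W.stableFaltingsHeight) ^ γ < ℓ → W.HasIrreducibleModPGaloisRep ℓ :=
  stub_irreducibleThreshold hMW hCM

end Summit.ABC.ABC.Theorems.IsotypicMinkowski

end
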